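import Literature.AlgebraicGeometry.Deformation.FrameCoverRestrict
import Literature.AlgebraicGeometry.Deformation.LiftedTransitionsReframe
import Literature.AlgebraicGeometry.Modules.CechEndCochainReframe
import HarnessLib

/-!
# The obstruction cocycle does not depend on the frames

Setting of `Deformation/DefectCochain.lean`: `j : Y ⟶ Z₀`, `i : Z₀ ⟶ Z₁` a first-order thickening,
`eI : i_* j_* 𝒪_Y ≅ 𝓘`, an `𝒪_{Z₀}`-module `F` with a frame cover `C = (U_a, I_a, e_a)`, lifts
`L = (T̃_{ab})`, and new frames `e'_a` over the same opens with mutually inverse lifted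
change-of-frame matrices `Φ = (ũ_a, ũ'_a)` (`Deformation/LiftedTransitionsReframe.lean`; they exist
when the `U_a` are affine). The transformed lifts `T̃' = ũ' T̃ ũ` have conjugated defect
`c' = ũ'_a c ũ_d` (`defect_reframe`), hence

* `kdefAt_reframe` — `κ(c') = ū'_a κ(c) ū_d` on `Y`;
* `u_baseFraming` / `u'_baseFraming` — the change-of-frame matrices between the two base framings
  of `E = j^*F` are the reductions `ū_a`, `ū'_a` (an instance of
  `transition_pullbackFrame_of_map_eq`, the frame-pair form of `T_baseFraming`);
* `conj_defectCochain_reframe` — conjugating the new defect cochain back gives the old one;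
* `toLocalFamily_defectCochain_reframe` — **the families of local endomorphisms of the two defect
  cochains are EQUAL** (`Modules/CechEndCochainReframe.lean`), so the obstruction cocycle, as a
  Čech cocycle of `𝓔nd(E)`, does not depend on the frames (for lifts related by `Φ`; for arbitrary
  lifts it changes by a coboundary, `Deformation/ObstructionCocycle.lean`).

Hartshorne, *Deformation Theory*, proof of Thm. 7.1 ("the class is independent of the choices").
Everything is proved; no named facts.

## References

* R. Hartshorne, *Deformation Theory*, GTM 257 (2010), §7, proof of Thm. 7.1. [Hartshorne2010]
* R. Hartshorne, *Algebraic Geometry*, GTM 52 (1977), II.5 (p. 109). [Hartshorne1977]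
-/

noncomputable section

open CategoryTheory AlgebraicGeometry Opposite TopologicalSpace Limits

namespace Literature.AlgebraicGeometry.Deformation

open Literature.AlgebraicGeometry.Modules Literature.AlgebraicGeometry.Motives

universe u

variable {Y Z₀ Z₁ : Scheme.{u}} {j : Y ⟶ Z₀} {i : Z₀ ⟶ Z₁} {F : Z₀.Modules} {ι : Type u}

/-! ### Transition matrices of pulled-back frames from a lift of the transition matrix -/

/-- **`T(j^*e_A, j^*e_B) = red(M)` over `j⁻¹i⁻¹W` whenever `i♯M = T(e_A, e_B)` over `i⁻¹W`**, for
frames `e_A`, `e_B` of `F` over `i⁻¹U_A`, `i⁻¹U_B` and `W ≤ U_A ∩ U_B`. [folklore] -/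
theorem transition_pullbackFrame_of_map_eq (j : Y ⟶ Z₀) {IA IB : Type u} [Fintype IA] [Fintype IB]
    {UA UB : Z₁.Opens} (eA : SheafOfModules.free IA ≅ F.over (i ⁻¹ᵁ UA))
    (eB : SheafOfModules.free IB ≅ F.over (i ⁻¹ᵁ UB)) (W : Z₁.Opens) (hA : W ≤ UA) (hB : W ≤ UB)
    (M : Matrix IA IB Γ(Z₁, W))
    (hM : M.map (i.app W).hom =
      transition eA eB ((Opens.map i.base).map (homOfLE hA)) ((Opens.map i.base).map (homOfLE hB))) :
    transition (pullbackFrame j eA) (pullbackFrame j eB)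
        (homOfLE ((Opens.map j.base).map ((Opens.map i.base).map (homOfLE hA))).le)
        (homOfLE ((Opens.map j.base).map ((Opens.map i.base).map (homOfLE hB))).le) =
      M.map (red j i W) := by
  have hl : baseOpen j i W ≤ j ⁻¹ᵁ (i ⁻¹ᵁ UA ⊓ i ⁻¹ᵁ UB) :=
    ((Opens.map j.base).map ((Opens.map i.base).map (homOfLE (le_inf hA hB)))).le
  have h1 := transition_pullbackFrame j eA eB hl
    (homOfLE ((Opens.map j.base).map ((Opens.map i.base).map (homOfLE hA))).le)
    (homOfLE ((Opens.map j.base).map ((Opens.map i.base).map (homOfLE hB))).le)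
  have h2 : transition eA eB ((Opens.map i.base).map (homOfLE hA)) ((Opens.map i.base).map (homOfLE hB)) =
      (transition eA eB (homOfLE inf_le_left) (homOfLE inf_le_right)).map
        (secRes Z₀ ((Opens.map i.base).map (homOfLE (le_inf hA hB))).le) := by
    exact ((transition_map eA eB (homOfLE inf_le_left) (homOfLE inf_le_right)
      ((Opens.map i.base).map (homOfLE (le_inf hA hB)))).trans
      (congrArg₂ (transition eA eB) (Subsingleton.elim _ _) (Subsingleton.elim _ _))).symm
  have h3 : M.map (red j i W) = (transition eA eB (homOfLE inf_le_left) (homOfLE inf_le_right)).map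
      ((j.app (i ⁻¹ᵁ W)).hom ∘ secRes Z₀ ((Opens.map i.base).map (homOfLE (le_inf hA hB))).le) := by
    rw [← Matrix.map_map, ← h2, ← hM, Matrix.map_map]
    rfl
  refine (h1.trans ?_).trans h3.symm
  ext r s
  simp only [Matrix.map_apply]
  exact (FrameCover.app_secRes_eq_appLE _ _).symm

namespace FrameCover

variable (C : FrameCover i F ι) {I' : ι → Type u} [∀ a, Fintype (I' a)] [∀ a, DecidableEq (I' a)]
  {e' : ∀ a, SheafOfModules.free (I' a) ≅ F.over (i ⁻¹ᵁ (C.U a))} (Φ : C.LiftedFrameChange e')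

/-! ### The change-of-frame matrices between the two base framings -/

variable (j)

/-- **`u_a = T(j^*e_a, j^*e'_a) = red(ũ_a)`** over `j⁻¹i⁻¹W`. [folklore] -/
theorem u_baseFraming (a : ι) (W : Z₁.Opens) (ha : W ≤ C.U a) :
    (C.baseFraming j).u (fun a => pullbackFrame j (e' a)) a (baseOpen j i W) (baseOpen_mono j i ha) =
      (Φ.VOn a W ha).map (red j i W) :=
  transition_pullbackFrame_of_map_eq j (C.e a) (e' a) W ha ha _ (Φ.map_VOn a W ha)

/-- **`u'_a = T(j^*e'_a, j^*e_a) = red(ũ'_a)`** over `j⁻¹i⁻¹W`. [folklore] -/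
theorem u'_baseFraming (a : ι) (W : Z₁.Opens) (ha : W ≤ C.U a) :
    (C.baseFraming j).u' (fun a => pullbackFrame j (e' a)) a (baseOpen j i W) (baseOpen_mono j i ha) =
      (Φ.V'On a W ha).map (red j i W) :=
  transition_pullbackFrame_of_map_eq j (e' a) (C.e a) W ha ha _ (Φ.map_V'On a W ha)

variable {j}

namespace Lifts

variable {C} (L : C.Lifts)
  (eI : (Scheme.Modules.pushforward i).obj ((Scheme.Modules.pushforward j).obj (unitModule Y)) ≅
    idealModule i)

/-! ### `κ` of the conjugated defect -/

/-- **`κ(c') = ū'_a κ(c) ū_d`.** [folklore] -/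
theorem kdefAt_reframe (a b d : ι) (W : Z₁.Opens) (ha : W ≤ C.U a) (hb : W ≤ C.U b) (hd : W ≤ C.U d) :
    (L.reframe Φ).kdefAt eI a b d W ha hb hd =
      (Φ.V'On a W ha).map (red j i W) * L.kdefAt eI a b d W ha hb hd * (Φ.VOn d W hd).map (red j i W) := by
  have h0 : (Φ.V'On a W ha * L.defect a b d W ha hb hd).map (i.app W).hom = 0 :=
    map_mul_eq_zero_of_right W _ (L.map_defect a b d W ha hb hd)
  rw [kdefAt, kdefAt, matrixOfIdeal_congr eI W (L.defect_reframe Φ a b d W ha hb hd) _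
      (map_mul_eq_zero_of_left W h0 _),
    matrixOfIdeal_mul_right eI W _ _ h0, matrixOfIdeal_mul_left eI W _ _ (L.map_defect a b d W ha hb hd)]

/-- **Conjugating the defect cochain of the reframed data back gives the defect cochain.**
[cite: Hartshorne2010, §7 (proof of Thm. 7.1)] -/
theorem conj_defectCochain_reframe :
    Framing.Cochain.conj (𝔣 := C.baseFraming j) (e' := fun a => pullbackFrame j (e' a))
        ((L.reframe Φ).defectCochain eI) = L.defectCochain eI := by
  refine Framing.Cochain.ext fun α V hV => ?_
  rw [Framing.Cochain.conj_mat, defectCochain_mat, defectCochain_mat, kdefAt_reframe, Matrix.map_mul,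
    Matrix.map_mul, ← u_baseFraming j C Φ, ← u'_baseFraming j C Φ, Framing.u_map, Framing.u'_map,
    ← (C.baseFraming j).u_map (fun a => pullbackFrame j (e' a)) (α 0) (hV 0) le_rfl,
    ← (C.baseFraming j).u'_map (fun a => pullbackFrame j (e' a)) (α (Fin.last 2)) (hV (Fin.last 2)) le_rfl]
  have hid : ∀ {m n : Type u} (A : Matrix m n Γ(Y, V)), A.map (secRes Y (le_refl V)) = A := fun A => by
    ext r s; exact secRes_self _
  rw [hid, hid]
  set u₀ := (C.baseFraming j).u (fun a => pullbackFrame j (e' a)) (α 0) V (hV 0)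
  set u₀' := (C.baseFraming j).u' (fun a => pullbackFrame j (e' a)) (α 0) V (hV 0)
  set u₂ := (C.baseFraming j).u (fun a => pullbackFrame j (e' a)) (α (Fin.last 2)) V (hV (Fin.last 2))
  set u₂' := (C.baseFraming j).u' (fun a => pullbackFrame j (e' a)) (α (Fin.last 2)) V (hV (Fin.last 2))
  set κ := (L.kdefAt eI (α 0) (α 1) (α (Fin.last 2)) (C.U (α 0) ⊓ C.U (α 1) ⊓ C.U (α (Fin.last 2)))
    (inf_le_left.trans inf_le_left) (inf_le_left.trans inf_le_right) inf_le_right).map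
    (secRes Y (le_baseOpen_inf₃ (hV 0) (hV 1) (hV (Fin.last 2))))
  calc u₀ * (u₀' * κ * u₂) * u₂' = (u₀ * u₀') * κ * (u₂ * u₂') := by simp only [Matrix.mul_assoc]
    _ = κ := by rw [Framing.u_mul_u', Framing.u_mul_u', Matrix.one_mul, Matrix.mul_one]

/-- **The obstruction cocycle does not see the frames**: the families of local endomorphisms of the
defect cochains of `(C, L)` and of the reframed data `(C', ũ' T̃ ũ)` are equal.
[cite: Hartshorne2010, §7 (proof of Thm. 7.1)] -/
theorem toLocalFamily_defectCochain_reframe :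
    ((C.reframe e').baseFraming j).toLocalFamily ((L.reframe Φ).defectCochain eI) =
      (C.baseFraming j).toLocalFamily (L.defectCochain eI) := by
  change ((C.baseFraming j).reframe fun a => pullbackFrame j (e' a)).toLocalFamily ((L.reframe Φ).defectCochain eI) = _
  rw [Framing.toLocalFamily_reframe, conj_defectCochain_reframe]

end Lifts

end FrameCover

end Literature.AlgebraicGeometry.Deformation

end
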